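import Literature.Geometry.Symplectic.NearSymplecticAdaptedFrame
import Literature.Geometry.Symplectic.OrigamiUnfoldingProofs
import Mathlib.Analysis.SpecialFunctions.Sqrt
import HarnessLib

/-!
# Smooth wedge-Gram–Schmidt along a curve of definite triples

Topic `Geometry/Symplectic`; namespace `Literature.Geometry.Symplectic`.  Theorems only; no named
fact, no `sorry`.  `NearSymplecticAdaptedFrame.exists_wedgeOrthonormalTriple_of_definite`
Gram–Schmidts a definite triple of `2`-forms on `ℝ⁴` for the wedge-square form; here the same
explicit process is run along a `C^∞` one-parameter family `ζ_i(θ)` of such triples, and the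
output triple `η_k(θ)` is shown to be `C^∞` in `θ` (square roots of positive smooth functions and
quotients by non-vanishing ones) and `T`-periodic whenever the input is
(`exists_contDiff_wedgeOrthonormalTriple`).  On the way: the Pfaffian and the wedge pairing are
`C^∞` along smooth families (`contDiff_pfaffian_comp`, `contDiff_pfaffianPair`; the Pfaffian
itself is `contDiff_pfaffian` of `OrigamiUnfoldingProofs.lean`).  This is the parametric form of Perutz 2006,
Lemma 2.1 (b) needed to adapt coordinates smoothly ALONG a zero circle (Perutz 2006, §3, proof of
Lemma 3.1, step 1: "an orthonormal frame `(e₁, e₂, e₃)` for `N_{Z/X}`").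

## References

* T. Perutz, *Zero-sets of near-symplectic forms*, J. Symplectic Geom. 4 (2006), Lemma 2.1 (b)
  and §3. [Perutz2006]
-/

noncomputable section

open Set Function Module Literature.Geometry.Kaehler Literature.Topology.FourManifolds
open scoped ContDiff

namespace Literature.Geometry.Symplectic

/-! ### Smoothness of the Pfaffian and of the wedge pairing along families -/

variable {X : Type*} [NormedAddCommGroup X] [NormedSpace ℝ X]

/-- The Pfaffian of a `C^∞` family is `C^∞`. [folklore] -/
theorem contDiff_pfaffian_comp {f : X → (EuclideanSpace ℝ (Fin 4)) [⋀^Fin 2]→L[ℝ] ℝ}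
    (hf : ContDiff ℝ ∞ f) : ContDiff ℝ ∞ fun x ↦ pfaffian (f x) :=
  contDiff_pfaffian.comp hf

/-- The wedge pairing of two `C^∞` families is `C^∞`. [folklore] -/
theorem contDiff_pfaffianPair {f g : X → (EuclideanSpace ℝ (Fin 4)) [⋀^Fin 2]→L[ℝ] ℝ}
    (hf : ContDiff ℝ ∞ f) (hg : ContDiff ℝ ∞ g) :
    ContDiff ℝ ∞ fun x ↦ pfaffianPair (f x) (g x) := by
  unfold pfaffianPair
  exact ((contDiff_pfaffian_comp (hf.add hg)).sub (contDiff_pfaffian_comp hf)).sub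
    (contDiff_pfaffian_comp hg)

/-- **Smooth normalisation**: if `s Pf(f x) > 0` everywhere then `x ↦ (√(s Pf(f x)))⁻¹ • f x` is
`C^∞`. [folklore] -/
theorem contDiff_wedgeNormalize {f : X → (EuclideanSpace ℝ (Fin 4)) [⋀^Fin 2]→L[ℝ] ℝ} {s : ℝ}
    (hf : ContDiff ℝ ∞ f) (hpos : ∀ x, 0 < s * pfaffian (f x)) :
    ContDiff ℝ ∞ fun x ↦ (Real.sqrt (s * pfaffian (f x)))⁻¹ • f x := by
  have h1 : ContDiff ℝ ∞ fun x ↦ s * pfaffian (f x) :=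
    contDiff_const.mul (contDiff_pfaffian_comp hf)
  have h2 : ContDiff ℝ ∞ fun x ↦ Real.sqrt (s * pfaffian (f x)) :=
    h1.sqrt fun x ↦ (hpos x).ne'
  have h3 : ContDiff ℝ ∞ fun x ↦ (Real.sqrt (s * pfaffian (f x)))⁻¹ :=
    h2.inv fun x ↦ (Real.sqrt_pos.2 (hpos x)).ne'
  exact h3.smul hf

/-! ### The smooth Gram–Schmidt process -/

/-- **Smooth wedge-Gram–Schmidt along a curve.**  Let `ζ₀, ζ₁, ζ₂ : ℝ → Λ²(ℝ⁴)*` be `C^∞` and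
such that, for every `θ`, every combination `Σ aᵢ ζᵢ(θ)` with some `a_k ≠ 0` has `s Pf > 0`
(`s = ±1`: the triple is independent and spans a definite three-plane of sign `s`).  Then there is
a `C^∞` family of wedge-orthonormal triples `η_k(θ)` of Pfaffian `s`, triangular in the `ζᵢ(θ)`
(each `η_k(θ)` is a combination of the `ζᵢ(θ)` and conversely), which is `T`-periodic whenever
the `ζᵢ` are.  (The Gram–Schmidt process of `exists_wedgeOrthonormalTriple_of_definite`, run
pointwise; its coefficients are square roots of positive smooth functions and quotients by
non-vanishing ones.) [cite: Perutz2006, Lemma 2.1 (b)] -/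
theorem exists_contDiff_wedgeOrthonormalTriple {s : ℝ} (hs : s = 1 ∨ s = -1)
    {ζ : Fin 3 → ℝ → (EuclideanSpace ℝ (Fin 4)) [⋀^Fin 2]→L[ℝ] ℝ} (hζ : ∀ i, ContDiff ℝ ∞ (ζ i))
    (hdef : ∀ θ (a : Fin 3 → ℝ) (k : Fin 3), a k ≠ 0 → 0 < s * pfaffian (∑ i, a i • ζ i θ)) :
    ∃ η : Fin 3 → ℝ → (EuclideanSpace ℝ (Fin 4)) [⋀^Fin 2]→L[ℝ] ℝ,
      (∀ k, ContDiff ℝ ∞ (η k)) ∧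
      (∀ θ, IsWedgeOrthonormalTriple (η 0 θ) (η 1 θ) (η 2 θ) s) ∧
      (∀ θ, ∃ m n : Fin 3 → Fin 3 → ℝ,
        (∀ k, η k θ = ∑ i, m k i • ζ i θ) ∧ ∀ i, ζ i θ = ∑ k, n i k • η k θ) ∧
      ∀ T : ℝ, (∀ i θ, ζ i (θ + T) = ζ i θ) → ∀ k θ, η k (θ + T) = η k θ := by
  have hs0 : s ≠ 0 := by rcases hs with rfl | rfl <;> norm_num
  -- step 1: normalise `ζ₀`
  have hP0 : ∀ θ, 0 < s * pfaffian (ζ 0 θ) := fun θ ↦ by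
    simpa [Fin.sum_univ_three] using hdef θ ![1, 0, 0] 0 (by simp)
  set c₀ : ℝ → ℝ := fun θ ↦ (Real.sqrt (s * pfaffian (ζ 0 θ)))⁻¹ with hc₀
  have hc₀0 : ∀ θ, c₀ θ ≠ 0 := fun θ ↦ inv_ne_zero (Real.sqrt_pos.2 (hP0 θ)).ne'
  set η₁ : ℝ → (EuclideanSpace ℝ (Fin 4)) [⋀^Fin 2]→L[ℝ] ℝ := fun θ ↦ c₀ θ • ζ 0 θ with hη₁
  have hη₁s : ContDiff ℝ ∞ η₁ := contDiff_wedgeNormalize (hζ 0) hP0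
  have hη₁P : ∀ θ, pfaffian (η₁ θ) = s := fun θ ↦ pfaffian_normalize hs (hP0 θ)
  -- step 2: orthogonalise `ζ₁` against `η₁`, normalise
  set t₁ : ℝ → ℝ := fun θ ↦ pfaffianPair (η₁ θ) (ζ 1 θ) / (2 * s) with ht₁
  have ht₁s : ContDiff ℝ ∞ t₁ := (contDiff_pfaffianPair hη₁s (hζ 1)).div_const _
  set ζ₁ : ℝ → (EuclideanSpace ℝ (Fin 4)) [⋀^Fin 2]→L[ℝ] ℝ := fun θ ↦ ζ 1 θ - t₁ θ • η₁ θ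
    with hζ₁
  have hζ₁s : ContDiff ℝ ∞ ζ₁ := (hζ 1).sub (ht₁s.smul hη₁s)
  have hζ₁orth : ∀ θ, pfaffianPair (η₁ θ) (ζ₁ θ) = 0 := fun θ ↦
    pfaffianPair_orthogonalize hs0 (hη₁P θ) (ζ 1 θ)
  have hζ₁eq : ∀ θ, ζ₁ θ = ∑ i, (![-(t₁ θ * c₀ θ), 1, 0] : Fin 3 → ℝ) i • ζ i θ := by
    intro θ
    simp only [Fin.sum_univ_three, Matrix.cons_val_zero, Matrix.cons_val_one, Matrix.cons_val]
    simp only [hζ₁, hη₁]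
    module
  have hP1 : ∀ θ, 0 < s * pfaffian (ζ₁ θ) := fun θ ↦ by
    rw [hζ₁eq θ]; exact hdef θ _ 1 (by simp)
  set c₁ : ℝ → ℝ := fun θ ↦ (Real.sqrt (s * pfaffian (ζ₁ θ)))⁻¹ with hc₁
  have hc₁0 : ∀ θ, c₁ θ ≠ 0 := fun θ ↦ inv_ne_zero (Real.sqrt_pos.2 (hP1 θ)).ne'
  set η₂ : ℝ → (EuclideanSpace ℝ (Fin 4)) [⋀^Fin 2]→L[ℝ] ℝ := fun θ ↦ c₁ θ • ζ₁ θ with hη₂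
  have hη₂s : ContDiff ℝ ∞ η₂ := contDiff_wedgeNormalize hζ₁s hP1
  have hη₂P : ∀ θ, pfaffian (η₂ θ) = s := fun θ ↦ pfaffian_normalize hs (hP1 θ)
  have h12 : ∀ θ, pfaffianPair (η₁ θ) (η₂ θ) = 0 := fun θ ↦ by
    simp only [hη₂]; rw [pfaffianPair_smul_right, hζ₁orth, mul_zero]
  -- step 3: orthogonalise `ζ₂` against `η₁, η₂`, normalise
  set u₁ : ℝ → ℝ := fun θ ↦ pfaffianPair (η₁ θ) (ζ 2 θ) / (2 * s) with hu₁
  set u₂ : ℝ → ℝ := fun θ ↦ pfaffianPair (η₂ θ) (ζ 2 θ) / (2 * s) with hu₂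
  have hu₁s : ContDiff ℝ ∞ u₁ := (contDiff_pfaffianPair hη₁s (hζ 2)).div_const _
  have hu₂s : ContDiff ℝ ∞ u₂ := (contDiff_pfaffianPair hη₂s (hζ 2)).div_const _
  set ζ₂ : ℝ → (EuclideanSpace ℝ (Fin 4)) [⋀^Fin 2]→L[ℝ] ℝ :=
    fun θ ↦ ζ 2 θ - u₁ θ • η₁ θ - u₂ θ • η₂ θ with hζ₂
  have hζ₂s : ContDiff ℝ ∞ ζ₂ := ((hζ 2).sub (hu₁s.smul hη₁s)).sub (hu₂s.smul hη₂s)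
  have hζ₂orth₁ : ∀ θ, pfaffianPair (η₁ θ) (ζ₂ θ) = 0 := fun θ ↦ by
    simp only [hζ₂]
    rw [pfaffianPair_sub_right, pfaffianPair_smul_right, h12, mul_zero, sub_zero]
    exact pfaffianPair_orthogonalize hs0 (hη₁P θ) (ζ 2 θ)
  have hζ₂orth₂ : ∀ θ, pfaffianPair (η₂ θ) (ζ₂ θ) = 0 := fun θ ↦ by
    simp only [hζ₂]
    rw [sub_right_comm, pfaffianPair_sub_right, pfaffianPair_smul_right,
      pfaffianPair_comm (η₂ θ) (η₁ θ), h12, mul_zero, sub_zero]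
    exact pfaffianPair_orthogonalize hs0 (hη₂P θ) (ζ 2 θ)
  have hζ₂eq : ∀ θ, ζ₂ θ = ∑ i, (![u₂ θ * c₁ θ * t₁ θ * c₀ θ - u₁ θ * c₀ θ, -(u₂ θ * c₁ θ), 1] :
      Fin 3 → ℝ) i • ζ i θ := by
    intro θ
    simp only [Fin.sum_univ_three, Matrix.cons_val_zero, Matrix.cons_val_one, Matrix.cons_val]
    simp only [hζ₂, hη₂, hζ₁, hη₁]
    module
  have hP2 : ∀ θ, 0 < s * pfaffian (ζ₂ θ) := fun θ ↦ by
    rw [hζ₂eq θ]; exact hdef θ _ 2 (by simp)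
  set c₂ : ℝ → ℝ := fun θ ↦ (Real.sqrt (s * pfaffian (ζ₂ θ)))⁻¹ with hc₂
  have hc₂0 : ∀ θ, c₂ θ ≠ 0 := fun θ ↦ inv_ne_zero (Real.sqrt_pos.2 (hP2 θ)).ne'
  set η₃ : ℝ → (EuclideanSpace ℝ (Fin 4)) [⋀^Fin 2]→L[ℝ] ℝ := fun θ ↦ c₂ θ • ζ₂ θ with hη₃
  have hη₃s : ContDiff ℝ ∞ η₃ := contDiff_wedgeNormalize hζ₂s hP2
  have hη₃P : ∀ θ, pfaffian (η₃ θ) = s := fun θ ↦ pfaffian_normalize hs (hP2 θ)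
  have h13 : ∀ θ, pfaffianPair (η₁ θ) (η₃ θ) = 0 := fun θ ↦ by
    simp only [hη₃]; rw [pfaffianPair_smul_right, hζ₂orth₁, mul_zero]
  have h23 : ∀ θ, pfaffianPair (η₂ θ) (η₃ θ) = 0 := fun θ ↦ by
    simp only [hη₃]; rw [pfaffianPair_smul_right, hζ₂orth₂, mul_zero]
  have hW : ∀ θ, IsWedgeOrthonormalTriple (η₁ θ) (η₂ θ) (η₃ θ) s := fun θ ↦
    ⟨hs0, hη₁P θ, hη₂P θ, hη₃P θ, h12 θ, h13 θ, h23 θ⟩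
  refine ⟨![η₁, η₂, η₃], ?_, fun θ ↦ hW θ, fun θ ↦ ?_, ?_⟩
  · intro k
    fin_cases k
    · exact hη₁s
    · exact hη₂s
    · exact hη₃s
  · -- the triangular change of basis and its inverse (as in the pointwise version)
    refine ⟨![![c₀ θ, 0, 0], ![-(c₁ θ * t₁ θ * c₀ θ), c₁ θ, 0],
        ![c₂ θ * (u₂ θ * c₁ θ * t₁ θ * c₀ θ - u₁ θ * c₀ θ), -(c₂ θ * u₂ θ * c₁ θ), c₂ θ]],
      ![![(c₀ θ)⁻¹, 0, 0], ![t₁ θ, (c₁ θ)⁻¹, 0], ![u₁ θ, u₂ θ, (c₂ θ)⁻¹]], ?_, ?_⟩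
    · intro k
      fin_cases k
      · simp only [Fin.sum_univ_three, Fin.zero_eta, Fin.isValue, Matrix.cons_val_zero,
          Matrix.cons_val_one, Matrix.cons_val]
        simp only [hη₁]
        module
      · simp only [Fin.sum_univ_three, Fin.mk_one, Fin.isValue, Matrix.cons_val_zero,
          Matrix.cons_val_one, Matrix.cons_val]
        simp only [hη₂, hζ₁, hη₁]
        module
      · simp only [Fin.sum_univ_three, Fin.reduceFinMk, Fin.isValue, Matrix.cons_val_zero,
          Matrix.cons_val_one, Matrix.cons_val]
        simp only [hη₃, hζ₂, hη₂, hζ₁, hη₁]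
        module
    · intro i
      fin_cases i
      · simp only [Fin.sum_univ_three, Fin.zero_eta, Fin.isValue, Matrix.cons_val_zero,
          Matrix.cons_val_one, Matrix.cons_val]
        simp only [hη₁]
        rw [smul_smul, inv_mul_cancel₀ (hc₀0 θ)]
        module
      · simp only [Fin.sum_univ_three, Fin.mk_one, Fin.isValue, Matrix.cons_val_zero,
          Matrix.cons_val_one, Matrix.cons_val]
        simp only [hη₂]
        rw [inv_smul_smul₀ (hc₁0 θ)]
        simp only [hζ₁]
        module
      · simp only [Fin.sum_univ_three, Fin.reduceFinMk, Fin.isValue, Matrix.cons_val_zero,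
          Matrix.cons_val_one, Matrix.cons_val]
        simp only [hη₃]
        rw [inv_smul_smul₀ (hc₂0 θ)]
        simp only [hζ₂]
        module
  · -- periodicity: every quantity is a function of `(ζ₀(θ), ζ₁(θ), ζ₂(θ))`
    intro T hT k
    have e₁ : ∀ θ, η₁ (θ + T) = η₁ θ := fun θ ↦ by simp only [hη₁, hc₀, hT]
    have et₁ : ∀ θ, t₁ (θ + T) = t₁ θ := fun θ ↦ by simp only [ht₁, e₁, hT]
    have eζ₁ : ∀ θ, ζ₁ (θ + T) = ζ₁ θ := fun θ ↦ by simp only [hζ₁, et₁, e₁, hT]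
    have e₂ : ∀ θ, η₂ (θ + T) = η₂ θ := fun θ ↦ by simp only [hη₂, hc₁, eζ₁]
    have eu₁ : ∀ θ, u₁ (θ + T) = u₁ θ := fun θ ↦ by simp only [hu₁, e₁, hT]
    have eu₂ : ∀ θ, u₂ (θ + T) = u₂ θ := fun θ ↦ by simp only [hu₂, e₂, hT]
    have eζ₂ : ∀ θ, ζ₂ (θ + T) = ζ₂ θ := fun θ ↦ by simp only [hζ₂, eu₁, eu₂, e₁, e₂, hT]
    have e₃ : ∀ θ, η₃ (θ + T) = η₃ θ := fun θ ↦ by simp only [hη₃, hc₂, eζ₂]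
    intro θ
    fin_cases k
    · exact e₁ θ
    · exact e₂ θ
    · exact e₃ θ

end Literature.Geometry.Symplectic

end
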